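import Literature.NumberTheory.NumberFields.ClassGroupNormRelations
import HarnessLib

/-!
# Norm relations in `ℤ[G]` (Biasse–Fieker–Hofmann–Page 2022): push-forward along an injective group
# homomorphism `s : G ↪ G'` — a relation of `G` w.r.t. `(Hᵢ)` is a relation of `G'` w.r.t. `(s Hᵢ)`

Topic `NumberTheory/NumberFields`; companion of `ClassGroupNormRelations.lean` (§3 there transports a relation
along an ISOMORPHISM `G ≃* G'`).  THEOREM-ONLY file (no definition, no named fact, no `sorry`), written by the
literature seat `bsd-potss-conjA-anchor` g11 (cell `bsd-potss`; supports stmt-BirchSwinnertonDyer-19386 / 19413;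
closes nothing).

[BiasseEtAl2022] J.-F. Biasse, C. Fieker, T. Hofmann, A. Page, *Norm relations and computational problems in number
fields*, J. London Math. Soc. 105 (2022) 2373–2414, Def. 2.1 (held text `paper:arxiv-2002.12332`, p. 6): «A norm
relation over `R` with respect to `𝓗` … is an equality of the form `1 = ∑ᵢ aᵢ N_{Hᵢ} bᵢ` with `aᵢ, bᵢ ∈ R[G]` and
`Hᵢ ∈ 𝓗`, `Hᵢ ≠ 1`, where the equality holds in `R[G]`» — cleared of denominators, `d = ∑ᵢ aᵢ N_{Hᵢ} bᵢ` in `ℤ[G]`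
(§3 eq. (⋆⋆)), stated coefficientwise in the tree (`hrel`, see `ClassGroupNormRelations.lean`).  Since the
definition is an identity in the group ring, it is preserved by the ring embedding `ℤ[G] ↪ ℤ[G']` induced by an
injective group homomorphism `s : G → G'` (which maps `N_H` to `N_{s(H)}`): the SAME `d` is the denominator of a norm
relation of `G'` with respect to the subgroups `s(Hᵢ) ≤ G'`, with coefficients `aᵢ, bᵢ` extended by zero off `s(G)`.

* `normRelation_map_of_injective` — this push-forward, coefficientwise.

Use (cell `bsd-potss`, μ-descent along the cyclotomic tower): a relation certified for `Gal(L/F)` is pushed into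
`Gal(L·F_n/F) ≅ Gal(L/F) × ℤ/pⁿ` along the section `Gal(L/F) ↪ Gal(L·F_n/F)` of elements acting trivially on `F_n`
(`Literature/NumberTheory/IwasawaTheory/ClassicalMuVanishesNormRelationTower.lean`), where
`NormRelation.padicValNat_card_classGroup_le_sum_of_normRelation` then bounds `v_p h(L·F_n)`.
-/

noncomputable section

namespace Literature.NumberTheory.NumberFields.NormRelation

section Pushforward

variable {G G' : Type*} [Group G] [Fintype G] [DecidableEq G] [Group G'] [Fintype G'] [DecidableEq G']

omit [Group G] [DecidableEq G] [Group G'] in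
/-- A finite sum over `G'` of a function vanishing off the range of an injective `s : G → G'` is the sum over `G`
of its pull-back. [cite: BiasseEtAl2022, Def. 2.1] -/
private theorem sum_eq_sum_comp_of_injective {M : Type*} [AddCommMonoid M] (s : G → G')
    (hs : Function.Injective s) (T : G' → M) (hT : ∀ y, y ∉ Set.range s → T y = 0) :
    ∑ y, T y = ∑ x, T (s x) := by
  rw [← Finset.sum_image (f := T) (s := Finset.univ) (g := s) fun x _ y _ h => hs h]
  symm
  refine Finset.sum_subset (Finset.subset_univ _) fun y _ hy => hT y ?_
  rintro ⟨x, rfl⟩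
  exact hy (Finset.mem_image_of_mem s (Finset.mem_univ x))

/-- **Push-forward of a norm relation along an injective group homomorphism** ([BiasseEtAl2022] Def. 2.1 is an
identity in the group ring, preserved by `ℤ[G] ↪ ℤ[G']`, `N_H ↦ N_{s(H)}`): if `d = ∑ᵢ aᵢ N_{Hᵢ} bᵢ` in `ℤ[G]`
(coefficientwise, `hrel`) and `s : G →* G'` is injective, then `d = ∑ᵢ aᵢ' N_{s(Hᵢ)} bᵢ'` in `ℤ[G']`, where
`aᵢ' = Function.extend s aᵢ 0`, `bᵢ' = Function.extend s bᵢ 0` are `aᵢ, bᵢ` transported to `s(G)` and extended by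
zero.  (For an isomorphism this is `normRelation_map_mulEquiv`.) [cite: BiasseEtAl2022, Def. 2.1] -/
theorem normRelation_map_of_injective (s : G →* G') (hs : Function.Injective s) {ι : Type*} [Fintype ι]
    (H : ι → Subgroup G) [∀ i, Fintype (H i)] [∀ i, Fintype ((H i).map s)] (a b : ι → G → ℤ) (d : ℕ)
    (hrel : ∀ g : G, (∑ i, ∑ x : G, ∑ h : H i, a i x * b i ((h : G)⁻¹ * x⁻¹ * g)) =
      if g = 1 then (d : ℤ) else 0)
    (g' : G') :
    (∑ i, ∑ x' : G', ∑ h' : (H i).map s,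
        Function.extend s (a i) 0 x' * Function.extend s (b i) 0 ((h' : G')⁻¹ * x'⁻¹ * g')) =
      if g' = 1 then (d : ℤ) else 0 := by
  classical
  have hext_a : ∀ i x, Function.extend s (a i) 0 (s x) = a i x := fun i x => hs.extend_apply _ _ x
  have hext_b : ∀ i x, Function.extend s (b i) 0 (s x) = b i x := fun i x => hs.extend_apply _ _ x
  have hzero : ∀ (c : G → ℤ) (y : G'), y ∉ Set.range s → Function.extend (⇑s) c 0 y = 0 := by
    intro c y hy
    rw [Function.extend_apply' _ _ _ fun ⟨x, hx⟩ => hy ⟨x, hx⟩]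
    rfl
  -- restrict the sum over `x'` to `s(G)` and re-index `h' = s h`
  have step : ∀ i, (∑ x' : G', ∑ h' : (H i).map s,
      Function.extend s (a i) 0 x' * Function.extend s (b i) 0 ((h' : G')⁻¹ * x'⁻¹ * g')) =
      ∑ x : G, ∑ h : H i, a i x * Function.extend s (b i) 0 (s ((h : G)⁻¹ * x⁻¹) * g') := by
    intro i
    rw [sum_eq_sum_comp_of_injective s hs _ fun y hy => by simp [hzero _ y hy]]
    refine Finset.sum_congr rfl fun x _ => ?_
    simp_rw [hext_a]
    refine (Fintype.sum_equiv (Subgroup.equivMapOfInjective (H i) s hs).toEquiv _ _ fun h => ?_).symm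
    simp only [MulEquiv.toEquiv_eq_coe, MulEquiv.coe_toEquiv, Subgroup.coe_equivMapOfInjective_apply,
      map_mul, map_inv]
  simp_rw [step]
  by_cases hg' : g' ∈ Set.range s
  · obtain ⟨g, rfl⟩ := hg'
    have h1 : (if s g = 1 then (d : ℤ) else 0) = if g = 1 then (d : ℤ) else 0 := by
      simp only [map_eq_one_iff s hs]
    rw [h1, ← hrel g]
    refine Finset.sum_congr rfl fun i _ => Finset.sum_congr rfl fun x _ =>
      Finset.sum_congr rfl fun h _ => ?_
    rw [← map_mul, hext_b]
  · have h1 : g' ≠ 1 := by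
      rintro rfl
      exact hg' ⟨1, map_one s⟩
    rw [if_neg h1]
    refine Finset.sum_eq_zero fun i _ => Finset.sum_eq_zero fun x _ => Finset.sum_eq_zero fun h _ => ?_
    rw [hzero _ _ ?_, mul_zero]
    rintro ⟨y, hy⟩
    apply hg'
    refine ⟨((h : G)⁻¹ * x⁻¹)⁻¹ * y, ?_⟩
    rw [map_mul, hy, map_inv, inv_mul_cancel_left]

end Pushforward

end Literature.NumberTheory.NumberFields.NormRelation
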